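import Summits.BirchSwinnertonDyer.BirchSwinnertonDyer.Theorems.GoldfeldAllTwistsTwoConverseTwinAdditiveTwoAdicPOne
import Summits.BirchSwinnertonDyer.BirchSwinnertonDyer.Theorems.GoldfeldAllTwistsTwoConverseTwinSplitSymbolQuartic
import Mathlib.NumberTheory.LegendreSymbol.QuadraticChar.Basic
import HarnessLib

set_option linter.dupNamespace false -- namespace `…BirchSwinnertonDyer.BirchSwinnertonDyer…` is the cell's (D-0017 nested layout)
set_option autoImplicit false

/-!
# OBJECT A7⁺, tranche T1, file D⁺-0′: the LOCAL KILLS of the cell a75+ (`q ≡ 7 (8)`, `p ≡ 5 (8)`, type α, `(p/q) = +1`) — at the prime `2` the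
# classes `p, 7p ∈ S(W)` (`W = 49a1^{(−2qp)}`; two numeric `ℚ₂`-certificates `(210; 5, 2240)`, `(210; 35, 320)`), and at the prime `p` the type-α key
# for `p ≡ 5 (mod 8)` (FACT-FREE)

Cell `bsd-goldfeld`, seat `bsd-goldfeld-s1p-c3x` (gen 15); planner RULING (ccclxxxii) ORDER «OBJECT A7⁺ BY THE χ_Z CHANNEL», tranche T1 (memo
`HOME/PLUS-CHIZ-CHANNEL.md` §2 D⁺; the seat's kill tables `kills_a7x_plus.txt`: on a75+ the classes `p, 7p` of `S(W)` die ONLY at `2`, the classes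
`2p, 14p` at `2` and at `p`). `--supports stmt-BirchSwinnertonDyer-19140` as a HELPER. Theses-free; theorems only; no definition, no fact binder, no `sorry`.
FRONTIER-grade: a twist-density-ZERO sub-family; never distance-to-summit.

* §1 Two numeric kills: `w² = 5u⁴ + 210u²z² + 2240z⁴` and `w² = 35u⁴ + 210u²z² + 320z⁴` have no non-trivial `ℚ₂`-point — every key is modulo `8`
  (`decide`); the deep charts halve three times (`2240 → 560 → 140 → 35`, `320 → 80 → 20 → 5`, the engine `padicInt_two_sq_ne_of_descend` of C3-1a)
  and land on the other quartic's shallow chart.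
* §2 The rescaled class kills on `(q, p) ≡ (7, 5) (mod 8)`: classes `p, 7p` of `S(−42qp, 448q²p²)` (`p ↦ 5` by `isSoluble_two_of_common_factor`,
  `5p ≡ 1 (8)`; `q ↦ −1` by `isSoluble_two_of_sq_factor`).
* §3 The type-α key at `p ≡ 5 (mod 8)`: a root `V` of `V² − 42V + 448` IS a square mod `p` (`s = V − 21` has `s² = −7`; the symbol
  `symbolNeg_iff_not_exists_pow_four` says `2((−s) − 21) = −2V` is a non-square, and `−2` is a non-square for `p ≡ 5 (8)`) — the sign-flipped
  twin of D⁺-1's `not_isSquare_of_sq_sub_fortyTwo_mul_add_of_alpha` (`p ≡ 1 (8)`: there `V` is a NON-square).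
HONEST FRAMING: local lemmas only; no Selmer group is bounded in this file; items 19140 / 19350 / 20044 unchanged; BSD is not proved by any of this.

References: [SilvermanAEC2009] Prop. X.4.9, Example X.4.10; [Serre1973] Ch. II §3.3 Thm 4; [CoatesLiTianZhai2015] §5 (type α / β).
-/

noncomputable section

open scoped Classical

open WeierstrassCurve Literature.NumberTheory.EllipticCurves

namespace Summit.BirchSwinnertonDyer.BirchSwinnertonDyer.Theorems.GoldfeldGoodTwists

/-! ## §1 Two numeric `ℚ₂`-kills (all keys modulo `8`) -/

section NumericPFive

/-- `ℤ/8` keys, shallow charts: `S² ≠ 5 + 210T² + 2240T⁴` and `S² ≠ 35 + 210T² + 320T⁴`. [folklore] -/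
theorem keys_shallow_plusPFive :
    (∀ T S : ZMod (2 ^ 3), S ^ 2 ≠ ((5 : ℤ) : ZMod (2 ^ 3)) + ((210 : ℤ) : ZMod (2 ^ 3)) * T ^ 2 + ((2240 : ℤ) : ZMod (2 ^ 3)) * T ^ 4) ∧
    (∀ T S : ZMod (2 ^ 3), S ^ 2 ≠ ((35 : ℤ) : ZMod (2 ^ 3)) + ((210 : ℤ) : ZMod (2 ^ 3)) * T ^ 2 + ((320 : ℤ) : ZMod (2 ^ 3)) * T ^ 4) := by
  refine ⟨?_, ?_⟩ <;> decide

/-- `ℤ/8` odd-`T` keys for the deep charts of `(210; 5, 2240)`: `2240, 560, 140 + 210(2T+1)² + (5, 20, 80)(2T+1)⁴` are never squares. [folklore] -/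
theorem keys_deep_five_plusPFive :
    (∀ T S : ZMod (2 ^ 3), S ^ 2 ≠ ((2240 : ℤ) : ZMod (2 ^ 3)) + ((210 : ℤ) : ZMod (2 ^ 3)) * (2 * T + 1) ^ 2 +
      ((5 : ℤ) : ZMod (2 ^ 3)) * (2 * T + 1) ^ 4) ∧
    (∀ T S : ZMod (2 ^ 3), S ^ 2 ≠ ((560 : ℤ) : ZMod (2 ^ 3)) + ((210 : ℤ) : ZMod (2 ^ 3)) * (2 * T + 1) ^ 2 +
      ((4 * 5 : ℤ) : ZMod (2 ^ 3)) * (2 * T + 1) ^ 4) ∧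
    (∀ T S : ZMod (2 ^ 3), S ^ 2 ≠ ((140 : ℤ) : ZMod (2 ^ 3)) + ((210 : ℤ) : ZMod (2 ^ 3)) * (2 * T + 1) ^ 2 +
      ((4 * (4 * 5) : ℤ) : ZMod (2 ^ 3)) * (2 * T + 1) ^ 4) := by
  refine ⟨?_, ?_, ?_⟩ <;> decide

/-- `ℤ/8` odd-`T` keys for the deep charts of `(210; 35, 320)`: `320, 80, 20 + 210(2T+1)² + (35, 140, 560)(2T+1)⁴` are never squares. [folklore] -/
theorem keys_deep_thirtyFive_plusPFive :
    (∀ T S : ZMod (2 ^ 3), S ^ 2 ≠ ((320 : ℤ) : ZMod (2 ^ 3)) + ((210 : ℤ) : ZMod (2 ^ 3)) * (2 * T + 1) ^ 2 +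
      ((35 : ℤ) : ZMod (2 ^ 3)) * (2 * T + 1) ^ 4) ∧
    (∀ T S : ZMod (2 ^ 3), S ^ 2 ≠ ((80 : ℤ) : ZMod (2 ^ 3)) + ((210 : ℤ) : ZMod (2 ^ 3)) * (2 * T + 1) ^ 2 +
      ((4 * 35 : ℤ) : ZMod (2 ^ 3)) * (2 * T + 1) ^ 4) ∧
    (∀ T S : ZMod (2 ^ 3), S ^ 2 ≠ ((20 : ℤ) : ZMod (2 ^ 3)) + ((210 : ℤ) : ZMod (2 ^ 3)) * (2 * T + 1) ^ 2 +
      ((4 * (4 * 35) : ℤ) : ZMod (2 ^ 3)) * (2 * T + 1) ^ 4) := by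
  refine ⟨?_, ?_, ?_⟩ <;> decide

/-- Shallow chart of `(210; 5, 2240)`: `s² ≠ 5 + 210t² + 2240t⁴` in `ℤ₂`. [folklore] -/
theorem chart_five_plusPFive (t s : ℤ_[2]) :
    s ^ 2 ≠ ((5 : ℤ) : ℤ_[2]) + ((210 : ℤ) : ℤ_[2]) * t ^ 2 + ((2240 : ℤ) : ℤ_[2]) * t ^ 4 :=
  padicInt_two_sq_ne_of_zmodPow 3 keys_shallow_plusPFive.1 t s

/-- Shallow chart of `(210; 35, 320)`: `s² ≠ 35 + 210t² + 320t⁴` in `ℤ₂`. [folklore] -/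
theorem chart_thirtyFive_plusPFive (t s : ℤ_[2]) :
    s ^ 2 ≠ ((35 : ℤ) : ℤ_[2]) + ((210 : ℤ) : ℤ_[2]) * t ^ 2 + ((320 : ℤ) : ℤ_[2]) * t ^ 4 :=
  padicInt_two_sq_ne_of_zmodPow 3 keys_shallow_plusPFive.2 t s

/-- **`w² = 5u⁴ + 210u²z² + 2240z⁴` has no non-trivial `ℚ₂`-point** (shallow chart mod `8`; deep chart: `u` odd dies mod `8`, `u` even halves three times,
`2240 → 560 → 140 → 35`, landing on the shallow chart of `(210; 35, 320)`). [cite: SilvermanAEC2009, Prop. X.4.9 and Example X.4.10] -/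
theorem not_isSoluble_two_numeric_five_plusPFive : ¬ ((twoIsogenyQuartic 210 5 2240).map (Int.castRingHom ℚ_[2])).IsSoluble := by
  obtain ⟨k1, k2, k3⟩ := keys_deep_five_plusPFive
  refine not_isSoluble_two_of_padicInt_charts chart_five_plusPFive ?_
  refine padicInt_two_sq_ne_of_descend 560 3 (by norm_num) k1 ?_
  refine padicInt_two_sq_ne_of_descend 140 3 (by norm_num) k2 ?_
  refine padicInt_two_sq_ne_of_descend 35 3 (by norm_num) k3 ?_
  intro t s; push_cast
  have h := chart_thirtyFive_plusPFive t s
  push_cast at h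
  convert h using 2

/-- **`w² = 35u⁴ + 210u²z² + 320z⁴` has no non-trivial `ℚ₂`-point** (shallow chart mod `8`; deep chart halves `320 → 80 → 20 → 5`, landing on the shallow
chart of `(210; 5, 2240)`). [cite: SilvermanAEC2009, Prop. X.4.9 and Example X.4.10] -/
theorem not_isSoluble_two_numeric_thirtyFive_plusPFive : ¬ ((twoIsogenyQuartic 210 35 320).map (Int.castRingHom ℚ_[2])).IsSoluble := by
  obtain ⟨k1, k2, k3⟩ := keys_deep_thirtyFive_plusPFive
  refine not_isSoluble_two_of_padicInt_charts chart_thirtyFive_plusPFive ?_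
  refine padicInt_two_sq_ne_of_descend 80 3 (by norm_num) k1 ?_
  refine padicInt_two_sq_ne_of_descend 20 3 (by norm_num) k2 ?_
  refine padicInt_two_sq_ne_of_descend 5 3 (by norm_num) k3 ?_
  intro t s; push_cast
  have h := chart_five_plusPFive t s
  push_cast at h
  convert h using 2

end NumericPFive

/-! ## §2 The class kills `p, 7p ∈ S(−42qp, 448q²p²)` at `2` on `(q, p) ≡ (7, 5) (mod 8)` -/

section ClassesPFive
variable {q p : ℕ}

/-- **Class `p ∈ S(−42qp, 448q²p²)` dies at `2`** (`q ≡ 7 (8)`, `p ≡ 5 (8)`): `p ↦ 5` (common factor, `5p ≡ 1 (8)`), `q ↦ −1` (square factor) give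
§1's numeric `(210; 5, 2240)`. [cite: SilvermanAEC2009, Prop. X.4.9 and Example X.4.10] [cite: Serre1973, Ch. II §3.3 Thm 4] -/
theorem not_isSoluble_two_class_P_plusPFive (hq8 : q % 8 = 7) (hp8 : p % 8 = 5) {a d d' : ℤ} (ha : a = -42 * ((q : ℤ) * p))
    (hd : d = (p : ℤ) * 1) (hd' : d' = (p : ℤ) * (448 * (q : ℤ) ^ 2)) : ¬ ((twoIsogenyQuartic a d d').map (Int.castRingHom ℚ_[2])).IsSoluble :=
  fun h ↦ by
  have h1 := isSoluble_two_of_common_factor (n := p) (n₀ := 5) (by omega) (a₀ := -42 * (q : ℤ)) (d₀ := 1) (e₀ := 448 * (q : ℤ) ^ 2)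
    (by rw [ha]; ring) (by rw [hd]) (by rw [hd']) h
  have h2 := isSoluble_two_of_sq_factor (n := q) (n₀ := -1) (by omega) (a₁ := 5 * (-42)) (d := 5 * 1) (e₁ := 5 * 448)
    (by ring) (by ring) h1
  norm_num at h2
  exact not_isSoluble_two_numeric_five_plusPFive h2

/-- **Class `7p ∈ S(−42qp, 448q²p²)` dies at `2`** (`q ≡ 7 (8)`, `p ≡ 5 (8)`): rescaled to §1's numeric `(210; 35, 320)`.
[cite: SilvermanAEC2009, Prop. X.4.9 and Example X.4.10] [cite: Serre1973, Ch. II §3.3 Thm 4] -/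
theorem not_isSoluble_two_class_sevenP_plusPFive (hq8 : q % 8 = 7) (hp8 : p % 8 = 5) {a d d' : ℤ} (ha : a = -42 * ((q : ℤ) * p))
    (hd : d = (p : ℤ) * 7) (hd' : d' = (p : ℤ) * (64 * (q : ℤ) ^ 2)) : ¬ ((twoIsogenyQuartic a d d').map (Int.castRingHom ℚ_[2])).IsSoluble :=
  fun h ↦ by
  have h1 := isSoluble_two_of_common_factor (n := p) (n₀ := 5) (by omega) (a₀ := -42 * (q : ℤ)) (d₀ := 7) (e₀ := 64 * (q : ℤ) ^ 2)
    (by rw [ha]; ring) (by rw [hd]) (by rw [hd']) h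
  have h2 := isSoluble_two_of_sq_factor (n := q) (n₀ := -1) (by omega) (a₁ := 5 * (-42)) (d := 5 * 7) (e₁ := 5 * 64)
    (by ring) (by ring) h1
  norm_num at h2
  exact not_isSoluble_two_numeric_thirtyFive_plusPFive h2

end ClassesPFive

/-! ## §3 The type-α key at `p ≡ 5 (mod 8)`: a root of `V² − 42V + 448` is a SQUARE -/

section KeyPFive
variable {p : ℕ} [Fact p.Prime]

/-- **Type α at `p ≡ 5 (mod 8)`: every `V ∈ 𝔽_p` with `V² − 42V + 448 = 0` is a non-zero SQUARE.** With `s = −(V − 21)` (`s² = −7`) the symbol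
`symbolNeg_iff_not_exists_pow_four` says `2(s − 21) = −2V` is a non-square; `−2` is a non-square for `p ≡ 5 (8)`, so `V` is a square (product of the
quadratic characters), and `V ≠ 0` since `448 ≠ 0`. [cite: CoatesLiTianZhai2015, §5 (type α)] -/
theorem isSquare_of_sq_sub_fortyTwo_mul_add_of_alpha_five (hp8 : p % 8 = 5) (hp7 : legendreSym p (-7) = 1)
    (hα : ¬ ∃ x : ZMod p, x ^ 4 = -7) {V : ZMod p} (hV : V ^ 2 - 42 * V + 448 = 0) : IsSquare V ∧ V ≠ 0 := by
  have hp : p.Prime := Fact.out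
  have hp2 : p ≠ 2 := by rintro rfl; norm_num at hp8
  have hp7' : p ≠ 7 := by rintro rfl; norm_num at hp8
  have hσ := (symbolNeg_iff_not_exists_pow_four (p := p) (by omega)).mpr hα
  obtain ⟨h2, -, hm1⟩ := legendreSym_two_seven_neg_one_of_five_mod_eight hp8 hp7
  -- `V ≠ 0`: `448 = 2⁶·7 ≠ 0` mod `p`
  have h448 : (448 : ZMod p) ≠ 0 := by
    have h2' : ((2 : ℕ) : ZMod p) ≠ 0 := by
      rw [Ne, ZMod.natCast_eq_zero_iff]; exact fun h ↦ hp2 ((Nat.prime_dvd_prime_iff_eq hp Nat.prime_two).mp h)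
    have h7' : ((7 : ℕ) : ZMod p) ≠ 0 := by
      rw [Ne, ZMod.natCast_eq_zero_iff]; exact fun h ↦ hp7' ((Nat.prime_dvd_prime_iff_eq hp (by norm_num)).mp h)
    have e : (448 : ZMod p) = ((2 : ℕ) : ZMod p) ^ 6 * ((7 : ℕ) : ZMod p) := by push_cast; norm_num
    rw [e]; exact mul_ne_zero (pow_ne_zero 6 h2') h7'
  have hV0 : V ≠ 0 := by
    rintro rfl; apply h448; simpa using hV
  -- `−2V` is a non-square (the type-α symbol at `s = −(V − 21)`)
  have hs : (-(V - 21)) ^ 2 = (-7 : ZMod p) := by linear_combination hV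
  have hns : ¬ IsSquare (-2 * V) := by
    have h := hσ (-(V - 21)) hs
    have e : (2 : ZMod p) * (-(V - 21) - 21) = -2 * V := by ring
    rwa [e] at h
  -- `−2` is a non-square for `p ≡ 5 (8)`
  have hm2 : ¬ IsSquare ((-2 : ℤ) : ZMod p) := by
    refine (legendreSym.eq_neg_one_iff p).mp ?_
    rw [show (-2 : ℤ) = -1 * 2 by norm_num, legendreSym.mul, hm1, h2]; norm_num
  -- quadratic characters multiply
  refine ⟨?_, hV0⟩
  by_contra hV
  have hχV : quadraticChar (ZMod p) V = -1 := (quadraticChar_neg_one_iff_not_isSquare).mpr hV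
  have hχ2 : quadraticChar (ZMod p) ((-2 : ℤ) : ZMod p) = -1 := (quadraticChar_neg_one_iff_not_isSquare).mpr hm2
  have hprod : quadraticChar (ZMod p) (-2 * V) = 1 := by
    rw [show (-2 * V : ZMod p) = ((-2 : ℤ) : ZMod p) * V by push_cast; ring, map_mul, hχ2, hχV]; norm_num
  have hsq : IsSquare (-2 * V) :=
    (quadraticChar_one_iff_isSquare (mul_ne_zero (by exact_mod_cast (show ((-2 : ℤ) : ZMod p) ≠ 0 from fun h ↦ hm2 ⟨0, by simp [h]⟩)) hV0)).mp hprod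
  exact hns hsq

end KeyPFive

end Summit.BirchSwinnertonDyer.BirchSwinnertonDyer.Theorems.GoldfeldGoodTwists

end
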